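import Summits.Langlands.Langlands.Theses.TranscendenceCarving

/-!
# Route TranscendenceCarving — Assembly

The assembly item (stmt-Langlands-27131) of the child route `TranscendenceCarving` (decomp-langlands lens-6 gen 20; a gate-native D-0170
refining child: `--refines route-Langlands-PadicReachabilityCarving:UnreachableCoreAtP`, edge split, depth 1, no FRAME item) for the
declared residual UR = `PadicReachabilityCarving.UnreachableCoreAtP` (stmt-Langlands-26901):
`AlgebraicTraceRigidity → LArithmeticity → CompatiblePairTraceIndependence → SatakeAvatarExistence → CompatibilityAwayFromLR →
PadicReachabilityCarving.UnreachableCoreAtP`.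

This is literally the type of the route file's sorry-free deciding theorem `Summit.Langlands.Langlands.Theses.TranscendenceCarving.closes`
(ATR ∧ LAR ⟹ DR; LIND ∧ W⁺ ∧ L∤R ∧ DR ⟹ S_p by a prime switch ℓ ↝ ℓ′ at v ∣ ℓ).  Nothing here proves `Langlands` (nor UR): the assembly
records only that the five ledger items of the route, taken together, imply the refined residual.
-/

set_option linter.dupNamespace false -- project-wide option (lakefile weak.linter.dupNamespace); `Summit.Langlands.Langlands` is the mandated namespace

namespace Summit.Langlands.Langlands.Theorems

/-- **Assembly of route TranscendenceCarving** (stmt-Langlands-27131):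
`ATR → LAR → LIND → W⁺ → L∤R → PadicReachabilityCarving.UnreachableCoreAtP`.
Proof: unfold `Assembly` and apply the route's deciding theorem `Theses.TranscendenceCarving.closes`. -/
theorem transcendenceCarving_assembly_proof :
    Summit.Langlands.Langlands.Theses.TranscendenceCarving.Assembly := by
  unfold Summit.Langlands.Langlands.Theses.TranscendenceCarving.Assembly
  exact Summit.Langlands.Langlands.Theses.TranscendenceCarving.closes

end Summit.Langlands.Langlands.Theorems
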